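/-
Copyright (c) 2026. All rights reserved.
Released under Apache 2.0 license as described in the file LICENSE.
Authors: abc-iut cell, seat abc-iut-w5-d226 (gen 3; ROW «P13-INPUT step 3», L4-lead RULING #6a).
-/
import Literature.AnabelianGeometry.AbsoluteAnabelian.AbsTopII.DPSCDataOfSemiGraph
import Literature.AnabelianGeometry.AbsoluteAnabelian.SlimTransport
import HarnessLib

/-!
# [AbsTopII] Prop 1.3, input "`Π_v` is slim" READ FROM layer L3's PSC datum

S. Mochizuki, *Topics in Absolute Anabelian Geometry II* [AbsTopII] (bib `MochizukiAbsTopII2013`; kurims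
manuscript `paper:url-585b8d0ad0d9`), §1 Prop 1.3 (iii) p. 11, proof p. 13: "Since `Π_v` is slim [cf.,
e.g., [Mzk13], Remark 1.1.3] …"; [CombGC] (bib `MochizukiCombGC2007`) Rmk 1.1.3 p. 8 (`Π_v` is the
pro-`Σ` fundamental group of a hyperbolic curve, hence slim and non-abelian).

PROOF-ONLY companion of `AbsTopII/DPSCDataOfSemiGraph.lean` (row I-slimv of
`plan/L4/SUBDAG-AbsTopII-Prop13.md`).  For a DPSC datum `X` PRESENTED by a PSC datum
`G : PSCDatum ↥X.PiG` (hypothesis `hV`: each chosen `Π_v` of `X` is, inside `Π_𝔾`, a conjugate of `G`'s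
verticial representative) the input "`Π_v` slim" of abc-iut-L4's `DPSCData.prop13iii_of_inputs` /
`Iv_inf_PiG_eq_bot` (file (E)) is EQUIVALENT to the same statement about `G`'s representatives
(`isSlimGroup_vertSub_of_psc`, `isSlimGroup_vertGp_of_psc`): slimness is invariant under conjugation and
under isomorphisms of topological groups (abc-iut-L4 `isSlimGroup_of_continuousMulEquiv`).  Hence
`prop13iii_of_psc'`: [AbsTopII] Prop 1.3 (iii) (first clauses, F-0275) for a PSC-presented DPSC datum
from [CombGC] Prop 1.2 (ii) for `G`, slimness OF `G`'S VERTICIAL SUBGROUPS, and "`I_v ↠ I`".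

HONEST SCOPE.  Layer L3 does NOT type [CombGC] Rmk 1.1.3 for `PSCDatum` (no decl concludes
`IsSlimGroup ↥(G.vertGp v)`); the L3 slimness that IS proved lives one interface away, at
`SemiGraphOfAnabelioids` of surface type ([SemiAnbd] Ex 2.10: `isVerticiallySlim_of_isOfSurfaceType
proSigmaSurfaceGroupSlim_holds`, vertex groups; `piVToPi_injective`, Prop 2.5 (i), verticial subgroups
≅ vertex groups) — a `PSCDatum`-from-`SemiGraphOfAnabelioids` producer does not exist in the tree, so
this file moves the input to the L3 side verbatim and no further.  Typed ≠ proved; nothing here bears on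
[IUTchIII] Cor 3.12 or takes a side on any author.
-/

open scoped Pointwise

namespace Literature.AnabelianGeometry.AbsoluteAnabelian

open Literature.AlgebraicGeometry.Frobenioids (IsSlimGroup)
open Literature.AnabelianGeometry.SemiGraphs

universe u

/-! ## §A. Slimness along conjugation and along the trace on a subgroup -/

section Generic

variable {Γ : Type u} [Group Γ] [TopologicalSpace Γ]

/-- A conjugate of a slim closed subgroup is slim (conjugation by `d` is an isomorphism of topological
groups `K ≃ₜ* d·K·d⁻¹`; [CombGC] Def 1.1 (ii): verticial subgroups are "determined up to conjugation").
[cite: MochizukiCombGC2007, Def 1.1(ii) p.6] -/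
theorem isSlimGroup_conjAct_smul [IsTopologicalGroup Γ] {K : Subgroup Γ} (hK : IsSlimGroup ↥K) (δ : ConjAct Γ) :
    IsSlimGroup ↥(δ • K : Subgroup Γ) := by
  rw [← ConjAct.toConjAct_ofConjAct δ, toConjAct_smul_subgroup_eq]
  set d : Γ := ConjAct.ofConjAct δ
  have hmem : ∀ x : Γ, x ∈ K → d * x * d⁻¹ ∈ (MulAut.conj d • K : Subgroup Γ) := fun x hx => by
    rw [Subgroup.mem_pointwise_smul_iff_inv_smul_mem, ← map_inv, MulAut.smul_def, MulAut.conj_apply]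
    simpa [mul_assoc] using hx
  have hmem' : ∀ y : Γ, y ∈ (MulAut.conj d • K : Subgroup Γ) → d⁻¹ * y * d ∈ K := fun y hy => by
    rw [Subgroup.mem_pointwise_smul_iff_inv_smul_mem, ← map_inv, MulAut.smul_def, MulAut.conj_apply,
      inv_inv] at hy
    exact hy
  let e : ↥K ≃ₜ* ↥(MulAut.conj d • K : Subgroup Γ) :=
    { toFun := fun x => ⟨d * x * d⁻¹, hmem x x.2⟩
      invFun := fun y => ⟨d⁻¹ * y * d, hmem' y y.2⟩
      left_inv := fun x => by ext; simp [mul_assoc]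
      right_inv := fun y => by ext; simp [mul_assoc]
      map_mul' := fun x y => by ext; simp [mul_assoc]
      continuous_toFun :=
        ((continuous_const.mul continuous_subtype_val).mul continuous_const).subtype_mk _
      continuous_invFun :=
        ((continuous_const.mul continuous_subtype_val).mul continuous_const).subtype_mk _ }
  exact isSlimGroup_of_continuousMulEquiv e hK

/-- For `K ⊆ N`, the trace `K ∩ N` read inside `N` and `K` itself are isomorphic topological groups, so
one is slim iff the other is ([CombGC] Def 1.1 (ii): subgroups of `Π_𝒢` read inside `Π_𝒢`).
[cite: MochizukiCombGC2007, Def 1.1(ii) p.6] -/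
theorem isSlimGroup_iff_subgroupOf (N : Subgroup Γ) {K : Subgroup Γ} (hK : K ≤ N) :
    IsSlimGroup ↥(K.subgroupOf N) ↔ IsSlimGroup ↥K := by
  let f : ↥(K.subgroupOf N) ≃ₜ* ↥K :=
    { Subgroup.subgroupOfEquivOfLe hK with
      continuous_toFun := by
        show Continuous fun g : ↥(K.subgroupOf N) => (⟨((g : ↥N) : Γ), g.2⟩ : ↥K)
        exact (continuous_subtype_val.comp continuous_subtype_val).subtype_mk _
      continuous_invFun := by
        show Continuous fun g : ↥K => (⟨⟨(g : Γ), hK g.2⟩, g.2⟩ : ↥(K.subgroupOf N))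
        exact (continuous_subtype_val.subtype_mk _).subtype_mk _ }
  exact isSlimGroup_congr f

end Generic

/-! ## §B. Row I-slimv at a PSC-presented DPSC datum -/

namespace DPSCData

variable (X : DPSCData.{u}) (G : PSCDatum ↥X.PiG) (eV : X.Vert ≃ G.graph.V)

/-- **Input I-slimv from the L3 side**: if `G`'s verticial representatives `Π_{G,w} ⊆ Π_𝔾` are slim
([CombGC] Rmk 1.1.3 "`Π_v` … slim"), then so is every chosen `Π_v ⊆ Π_H` of the presented DPSC datum —
the hypothesis `hslim` of `DPSCData.prop13iii_of_inputs` / `Iv_inf_PiG_eq_bot` (file (E)).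
[cite: MochizukiAbsTopII2013, Prop 1.3 (iii) p.13] [cite: MochizukiCombGC2007, Rmk 1.1.3 p.8] -/
theorem isSlimGroup_vertSub_of_psc
    (hV : ∀ v, ∃ δ : ConjAct ↥X.PiG, (X.vertSub v).subgroupOf X.PiG = δ • G.vertGp (eV v))
    (hslim : ∀ w : G.graph.V, IsSlimGroup ↥(G.vertGp w)) (v : X.Vert) :
    IsSlimGroup ↥(X.vertSub v) := by
  obtain ⟨δ, hδ⟩ := hV v
  rw [← isSlimGroup_iff_subgroupOf X.PiG (X.vertSub_le v), hδ]
  exact isSlimGroup_conjAct_smul (hslim (eV v)) δ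

/-- Conversely the DPSC-side input gives back slimness of `G`'s representatives: the two forms of row
I-slimv are EQUIVALENT under the presentation. [cite: MochizukiCombGC2007, Rmk 1.1.3 p.8] -/
theorem isSlimGroup_vertGp_of_psc
    (hV : ∀ v, ∃ δ : ConjAct ↥X.PiG, (X.vertSub v).subgroupOf X.PiG = δ • G.vertGp (eV v))
    (hslim : ∀ v : X.Vert, IsSlimGroup ↥(X.vertSub v)) (w : G.graph.V) :
    IsSlimGroup ↥(G.vertGp w) := by
  obtain ⟨δ, hδ⟩ := hV (eV.symm w)
  rw [Equiv.apply_symm_apply] at hδ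
  have h1 : IsSlimGroup ↥(δ • G.vertGp w : Subgroup ↥X.PiG) := by
    rw [← hδ, isSlimGroup_iff_subgroupOf X.PiG (X.vertSub_le _)]
    exact hslim _
  have h2 := isSlimGroup_conjAct_smul h1 δ⁻¹
  rwa [inv_smul_smul] at h2

/-- **[AbsTopII] Prop 1.3 (iii), first clauses, as typed** (`DPSCData.Prop13iii`, F-0275) for a
PSC-presented DPSC datum, every `Π_𝔾`-input now on the L3 side: [CombGC] Prop 1.2 (ii) for `G`
(`VerticialEdgeLikeCommensurablyTerminal`, printed fact F-0438) and slimness of `G`'s verticial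
subgroups ([CombGC] Rmk 1.1.3 — NOT typed in layer L3: stays the named hypothesis `hslim`); "`I_v ↠ I`"
(`hsurj`) is the geometric log-structure input of p. 13. [cite: MochizukiAbsTopII2013, Prop 1.3 (iii) p.11] -/
theorem prop13iii_of_psc'
    (hV : ∀ v, ∃ δ : ConjAct ↥X.PiG, (X.vertSub v).subgroupOf X.PiG = δ • G.vertGp (eV v))
    (hCT : G.VerticialEdgeLikeCommensurablyTerminal) (hslim : ∀ w : G.graph.V, IsSlimGroup ↥(G.vertGp w))
    (hsurj : ∀ v : X.Vert, X.Iv v ⊔ X.PiG = X.PiI) : X.Prop13iii :=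
  X.prop13iii_of_inputs (X.isCommensurablyTerminal_vertSub_of_psc G eV hV hCT)
    (X.isSlimGroup_vertSub_of_psc G eV hV hslim) hsurj

/-- **`I_v ∩ Π_𝔾 = {1}`** (p. 13 "Since `Π_v` is slim … and commensurably terminal …, `I_v ∩ Π_𝒢 = {1}`")
for a PSC-presented DPSC datum, both inputs on the L3 side. [cite: MochizukiAbsTopII2013, Prop 1.3 (iii) p.13] -/
theorem Iv_inf_PiG_eq_bot_of_psc
    (hV : ∀ v, ∃ δ : ConjAct ↥X.PiG, (X.vertSub v).subgroupOf X.PiG = δ • G.vertGp (eV v))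
    (hCT : G.VerticialEdgeLikeCommensurablyTerminal) (hslim : ∀ w : G.graph.V, IsSlimGroup ↥(G.vertGp w))
    (v : X.Vert) : X.Iv v ⊓ X.PiG = ⊥ :=
  X.Iv_inf_PiG_eq_bot (X.isCommensurablyTerminal_vertSub_of_psc G eV hV hCT)
    (X.isSlimGroup_vertSub_of_psc G eV hV hslim) v

end DPSCData

end Literature.AnabelianGeometry.AbsoluteAnabelian
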